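import Mathlib.RingTheory.SimpleModule.IsAlgClosed
import Mathlib.LinearAlgebra.BilinearForm.Properties
import Mathlib.LinearAlgebra.FiniteDimensional.Lemmas
import Mathlib.Data.Matrix.Basis
import HarnessLib

/-!
# Wedderburn blocks of a self-adjoint semisimple algebra of operators

Let `V` be a finite-dimensional vector space over a field `K`, `B` a non-degenerate alternating
bilinear form on `V` and `E ⊆ End_K V` a subalgebra which is semisimple, split
(`E ≃ₐ[K] Π i, Matrix (Fin dᵢ) (Fin dᵢ) K`, e.g. `K` algebraically closed, Wedderburn–Artin
`IsSemisimpleRing.exists_algEquiv_pi_matrix_of_isAlgClosed`) and stable under the adjoint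
involution `X ↦ X†`, `B (X† v) w = B v (X w)`.  This file sets up the bookkeeping used in
[Milne 1999, §2–§3] (centralizers of semisimple algebras with involution, the three types
symplectic / orthogonal / unitary of simple factors):

* `adj B hB X` — the adjoint, an anti-automorphism of `End V` with `X†† = X`
  (`adj_mul`, `adj_adj_of_isAlt`);
* `unit E ψ i a b`, `blockIdem E ψ i` — the matrix units `e^i_{ab}` and central idempotents `1_i`
  transported from the Wedderburn isomorphism `ψ`, with their multiplication table
  (`unit_mul_unit`, `unit_mul_unit_of_ne`, `sum_blockIdem`, `blockIdem_mul_mem_mul_blockIdem`);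
* `bar` — the involution of the index set with `(1_i)† = 1_{bar i}` (`adj_blockIdem`,
  `bar_bar`), and the resulting `B`-orthogonality `B (1_i v) (1_j w) = 0` for `j ≠ bar i`
  (`form_blockIdem_blockIdem_eq_zero`);
* `BlockSys` — a full system of matrix units of one block lying in `E` (the Wedderburn one,
  `wedderburnSys`, and its adjoint-transpose `BlockSys.transpose`, a system for the block `bar i`);
* `exists_smul_eq_sandwich` — for a self-dual block, `f₀₀ · E · e₀₀` is a line: the key to the
  factorisation of the Gram matrix of `B` on that block as (slot matrix) ⊗ (letter form).

## References
* [Milne 1999] J. S. Milne, *Lefschetz classes on abelian varieties*, Duke Math. J. 96 (1999),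
  §2 (semisimple algebras with involution and their centralizers). [cite: Milne1999LefschetzClasses, §2]
* R. Goodman, N. Wallach, *Symmetry, Representations, and Invariants*, GTM 255, §4.1
  (double commutant, isotypic decomposition). [cite: GoodmanWallachGTM255, §4.1]
-/

namespace Literature.RingTheory.SimpleModule

open Matrix

variable {K : Type*} [Field K] {V : Type*} [AddCommGroup V] [Module K V]

/-! ### The adjoint involution of a non-degenerate alternating form -/

section Adjoint

variable [FiniteDimensional K V] (B : LinearMap.BilinForm K V) (hB : B.Nondegenerate)

/-- The adjoint `X†` of an operator `X` with respect to the non-degenerate bilinear form `B`,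
characterised by `B (X† v) w = B v (X w)` (`adj_spec`). [cite: Milne1999LefschetzClasses, §2] -/
noncomputable def adj (X : Module.End K V) : Module.End K V :=
  B.leftAdjointOfNondegenerate hB X

/-- Defining property of the adjoint. [cite: Milne1999LefschetzClasses, §2] -/
theorem adj_spec (X : Module.End K V) (v w : V) : B (adj B hB X v) w = B v (X w) :=
  LinearMap.BilinForm.isAdjointPairLeftAdjointOfNondegenerate B hB X v w

/-- Uniqueness of the adjoint. [cite: Milne1999LefschetzClasses, §2] -/
theorem eq_adj_of_forall {X Y : Module.End K V} (h : ∀ v w, B (Y v) w = B v (X w)) :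
    Y = adj B hB X :=
  (LinearMap.BilinForm.isAdjointPair_iff_eq_of_nondegenerate B hB Y X).1 h

/-- `(XY)† = Y† X†`. [cite: Milne1999LefschetzClasses, §2] -/
theorem adj_mul (X Y : Module.End K V) : adj B hB (X * Y) = adj B hB Y * adj B hB X := by
  symm
  apply eq_adj_of_forall
  intro v w
  rw [Module.End.mul_apply, adj_spec, adj_spec, Module.End.mul_apply]

/-- `1† = 1`. [cite: Milne1999LefschetzClasses, §2] -/
theorem adj_one : adj B hB 1 = 1 := by
  symm
  apply eq_adj_of_forall
  intro v w
  rfl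

/-- Additivity of the adjoint. [cite: Milne1999LefschetzClasses, §2] -/
theorem adj_add (X Y : Module.End K V) : adj B hB (X + Y) = adj B hB X + adj B hB Y := by
  symm
  apply eq_adj_of_forall
  intro v w
  rw [LinearMap.add_apply, LinearMap.BilinForm.add_left, adj_spec, adj_spec, LinearMap.add_apply,
    LinearMap.BilinForm.add_right]

/-- Homogeneity of the adjoint. [cite: Milne1999LefschetzClasses, §2] -/
theorem adj_smul (c : K) (X : Module.End K V) : adj B hB (c • X) = c • adj B hB X := by
  symm
  apply eq_adj_of_forall
  intro v w
  rw [LinearMap.smul_apply, LinearMap.BilinForm.smul_left, adj_spec, LinearMap.smul_apply,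
    LinearMap.BilinForm.smul_right]

/-- `0† = 0`. [cite: Milne1999LefschetzClasses, §2] -/
theorem adj_zero : adj B hB 0 = 0 := by
  symm
  apply eq_adj_of_forall
  intro v w
  rw [LinearMap.zero_apply, LinearMap.zero_apply, LinearMap.BilinForm.zero_left,
    LinearMap.BilinForm.zero_right]

/-- The adjoint as a `K`-linear map. [cite: Milne1999LefschetzClasses, §2] -/
noncomputable def adjLinear : Module.End K V →ₗ[K] Module.End K V where
  toFun := adj B hB
  map_add' := adj_add B hB
  map_smul' := adj_smul B hB

/-- Unfolding lemma. [cite: Milne1999LefschetzClasses, §2] -/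
@[simp] theorem adjLinear_apply (X : Module.End K V) : adjLinear B hB X = adj B hB X := rfl

/-- `adj` commutes with finite sums. [cite: Milne1999LefschetzClasses, §2] -/
theorem adj_sum {ι : Type*} (s : Finset ι) (f : ι → Module.End K V) :
    adj B hB (∑ x ∈ s, f x) = ∑ x ∈ s, adj B hB (f x) := by
  simpa only [adjLinear_apply] using map_sum (adjLinear B hB) f s

/-- For an alternating form the adjoint is an involution: `X†† = X`.
[cite: Milne1999LefschetzClasses, §2] -/
theorem adj_adj_of_isAlt (hBa : B.IsAlt) (X : Module.End K V) : adj B hB (adj B hB X) = X := by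
  symm
  apply eq_adj_of_forall
  intro v w
  rw [← hBa.neg_eq (adj B hB X w) v, adj_spec, hBa.neg_eq]

/-- Moving an operator to the right argument: `B (X v) w = B v (X† w)` (alternating `B`).
[cite: Milne1999LefschetzClasses, §2] -/
theorem adj_spec' (hBa : B.IsAlt) (X : Module.End K V) (v w : V) :
    B (X v) w = B v (adj B hB X w) := by
  conv_lhs => rw [← adj_adj_of_isAlt B hB hBa X]
  rw [adj_spec]

end Adjoint

/-! ### Matrix units and block idempotents from a Wedderburn isomorphism -/

section Units

variable (E : Subalgebra K (Module.End K V)) {t : ℕ} {d : Fin t → ℕ}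
  (ψ : E ≃ₐ[K] Π i, Matrix (Fin (d i)) (Fin (d i)) K)

/-- The matrix unit `e^i_{ab} ∈ E` of the `i`-th Wedderburn block.
[cite: GoodmanWallachGTM255, §4.1] -/
noncomputable def unit (i : Fin t) (a b : Fin (d i)) : Module.End K V :=
  ↑(ψ.symm (Pi.single i (Matrix.single a b (1 : K))))

/-- The central idempotent `1_i ∈ E` of the `i`-th Wedderburn block.
[cite: GoodmanWallachGTM255, §4.1] -/
noncomputable def blockIdem (i : Fin t) : Module.End K V :=
  ↑(ψ.symm (Pi.single i (1 : Matrix (Fin (d i)) (Fin (d i)) K)))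

/-- Matrix units lie in `E`. [cite: GoodmanWallachGTM255, §4.1] -/
theorem unit_mem (i : Fin t) (a b : Fin (d i)) : unit E ψ i a b ∈ E := (ψ.symm _).2

/-- Block idempotents lie in `E`. [cite: GoodmanWallachGTM255, §4.1] -/
theorem blockIdem_mem (i : Fin t) : blockIdem E ψ i ∈ E := (ψ.symm _).2

/-- Products of pulled-back elements. [folklore] -/
private theorem coe_symm_mul (x y : Π i, Matrix (Fin (d i)) (Fin (d i)) K) :
    (↑(ψ.symm x) : Module.End K V) * ↑(ψ.symm y) = ↑(ψ.symm (x * y)) := by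
  rw [map_mul, Subalgebra.coe_mul]

/-- `Pi.single` is multiplicative in a fixed component. [folklore] -/
private theorem piSingle_mul_same (i : Fin t) (x y : Matrix (Fin (d i)) (Fin (d i)) K) :
    (Pi.single i x : Π j, Matrix (Fin (d j)) (Fin (d j)) K) * Pi.single i y =
      Pi.single i (x * y) := by
  funext j
  by_cases hj : j = i
  · subst hj; simp
  · simp [Pi.single_eq_of_ne hj]

/-- `Pi.single`s at different components multiply to zero. [folklore] -/
private theorem piSingle_mul_ne {i i' : Fin t} (h : i ≠ i') (x : Matrix (Fin (d i)) (Fin (d i)) K)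
    (y : Matrix (Fin (d i')) (Fin (d i')) K) :
    (Pi.single i x : Π j, Matrix (Fin (d j)) (Fin (d j)) K) * Pi.single i' y = 0 := by
  funext j
  by_cases hj : j = i
  · subst hj; simp [Pi.single_eq_of_ne h]
  · simp [Pi.single_eq_of_ne hj]

/-- Multiplication table of the matrix units of one block. [cite: GoodmanWallachGTM255, §4.1] -/
theorem unit_mul_unit (i : Fin t) (a b b' c : Fin (d i)) :
    unit E ψ i a b * unit E ψ i b' c = if b = b' then unit E ψ i a c else 0 := by
  unfold unit
  rw [coe_symm_mul, piSingle_mul_same]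
  split_ifs with h
  · subst h
    rw [Matrix.single_mul_single_same, mul_one]
  · rw [Matrix.single_mul_single_of_ne (h := h), Pi.single_zero, map_zero, ZeroMemClass.coe_zero]

/-- Matrix units of different blocks annihilate each other. [cite: GoodmanWallachGTM255, §4.1] -/
theorem unit_mul_unit_of_ne {i i' : Fin t} (h : i ≠ i') (a b : Fin (d i)) (a' b' : Fin (d i')) :
    unit E ψ i a b * unit E ψ i' a' b' = 0 := by
  unfold unit
  rw [coe_symm_mul, piSingle_mul_ne h, map_zero, ZeroMemClass.coe_zero]

/-- The block idempotent is the sum of the diagonal units. [cite: GoodmanWallachGTM255, §4.1] -/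
theorem sum_unit_diag (i : Fin t) : ∑ a, unit E ψ i a a = blockIdem E ψ i := by
  unfold unit blockIdem
  have hmat : ∑ a : Fin (d i), Matrix.single a a (1 : K) = 1 := by
    ext a b
    rw [Matrix.sum_apply, Matrix.one_apply]
    by_cases hab : a = b
    · subst hab
      rw [if_pos rfl, Finset.sum_eq_single a, Matrix.single_apply_same]
      · intro x _ hx
        exact Matrix.single_apply_of_ne _ _ _ _ _ (by rintro ⟨h1, -⟩; exact hx h1)
      · intro h
        exact absurd (Finset.mem_univ a) h
    · rw [if_neg hab]
      exact Finset.sum_eq_zero fun x _ =>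
        Matrix.single_apply_of_ne _ _ _ _ _ (by rintro ⟨h1, h2⟩; exact hab (h1.symm.trans h2))
  have h : (∑ a : Fin (d i), (Pi.single i (Matrix.single a a (1 : K)) :
      Π j, Matrix (Fin (d j)) (Fin (d j)) K)) = Pi.single i 1 := by
    funext j
    rw [Finset.sum_apply]
    by_cases hj : j = i
    · rw [hj]
      simp only [Pi.single_eq_same]
      exact hmat
    · simp only [Pi.single_eq_of_ne hj, Finset.sum_const_zero]
  rw [← h, map_sum, AddSubmonoidClass.coe_finsetSum]

/-- The block idempotents sum to `1`. [cite: GoodmanWallachGTM255, §4.1] -/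
theorem sum_blockIdem : ∑ i, blockIdem E ψ i = 1 := by
  unfold blockIdem
  have h : (∑ i, (Pi.single i (1 : Matrix (Fin (d i)) (Fin (d i)) K) :
      Π j, Matrix (Fin (d j)) (Fin (d j)) K)) = 1 := by
    funext j
    rw [Finset.sum_apply, Finset.sum_eq_single j, Pi.single_eq_same, Pi.one_apply]
    · intro x _ hx
      exact Pi.single_eq_of_ne (Ne.symm hx) _
    · intro hj
      exact absurd (Finset.mem_univ j) hj
  rw [← AddSubmonoidClass.coe_finsetSum, ← map_sum, h, map_one, OneMemClass.coe_one]

/-- Block idempotents are orthogonal idempotents. [cite: GoodmanWallachGTM255, §4.1] -/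
theorem blockIdem_mul_blockIdem (i j : Fin t) :
    blockIdem E ψ i * blockIdem E ψ j = if i = j then blockIdem E ψ i else 0 := by
  unfold blockIdem
  rw [coe_symm_mul]
  split_ifs with h
  · subst h
    rw [piSingle_mul_same, mul_one]
  · rw [piSingle_mul_ne h, map_zero, ZeroMemClass.coe_zero]

/-- Block idempotents are central in `E`. [cite: GoodmanWallachGTM255, §4.1] -/
theorem blockIdem_comm {X : Module.End K V} (hX : X ∈ E) (i : Fin t) :
    X * blockIdem E ψ i = blockIdem E ψ i * X := by
  have hX' : X = ↑(ψ.symm (ψ ⟨X, hX⟩)) := by simp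
  unfold blockIdem
  rw [hX', coe_symm_mul, coe_symm_mul]
  congr 2
  funext j
  rw [Pi.mul_apply, Pi.mul_apply]
  by_cases hj : j = i
  · subst hj; simp
  · simp [Pi.single_eq_of_ne hj]

/-- Units absorb their block idempotent on the right. [cite: GoodmanWallachGTM255, §4.1] -/
theorem unit_mul_blockIdem (i : Fin t) (a b : Fin (d i)) :
    unit E ψ i a b * blockIdem E ψ i = unit E ψ i a b := by
  unfold unit blockIdem
  rw [coe_symm_mul, piSingle_mul_same, mul_one]

/-- Units absorb their block idempotent on the left. [cite: GoodmanWallachGTM255, §4.1] -/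
theorem blockIdem_mul_unit (i : Fin t) (a b : Fin (d i)) :
    blockIdem E ψ i * unit E ψ i a b = unit E ψ i a b := by
  unfold unit blockIdem
  rw [coe_symm_mul, piSingle_mul_same, one_mul]

/-- Units of block `i` are killed by the other block idempotents (right).
[cite: GoodmanWallachGTM255, §4.1] -/
theorem unit_mul_blockIdem_of_ne {i j : Fin t} (h : i ≠ j) (a b : Fin (d i)) :
    unit E ψ i a b * blockIdem E ψ j = 0 := by
  unfold unit blockIdem
  rw [coe_symm_mul, piSingle_mul_ne h, map_zero, ZeroMemClass.coe_zero]

/-- Units of block `i` are killed by the other block idempotents (left).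
[cite: GoodmanWallachGTM255, §4.1] -/
theorem blockIdem_mul_unit_of_ne {i j : Fin t} (h : j ≠ i) (a b : Fin (d i)) :
    blockIdem E ψ j * unit E ψ i a b = 0 := by
  unfold unit blockIdem
  rw [coe_symm_mul, piSingle_mul_ne h, map_zero, ZeroMemClass.coe_zero]

/-- The image under `ψ` of a sandwiched element `1_i X 1_i` is concentrated in component `i`.
[cite: GoodmanWallachGTM255, §4.1] -/
theorem psi_blockIdem_mul_mul_blockIdem {X : Module.End K V} (hX : X ∈ E) (i : Fin t) :
    ψ ⟨blockIdem E ψ i * X * blockIdem E ψ i,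
        E.mul_mem (E.mul_mem (blockIdem_mem E ψ i) hX) (blockIdem_mem E ψ i)⟩ =
      Pi.single i (ψ ⟨X, hX⟩ i) := by
  have h1 : (⟨blockIdem E ψ i * X * blockIdem E ψ i,
      E.mul_mem (E.mul_mem (blockIdem_mem E ψ i) hX) (blockIdem_mem E ψ i)⟩ : E) =
      ψ.symm (Pi.single i 1) * ⟨X, hX⟩ * ψ.symm (Pi.single i 1) := by
    apply Subtype.ext
    simp only [Subalgebra.coe_mul]
    rfl
  rw [h1, map_mul, map_mul, AlgEquiv.apply_symm_apply]
  funext j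
  rw [Pi.mul_apply, Pi.mul_apply]
  by_cases hj : j = i
  · subst hj; simp
  · simp [Pi.single_eq_of_ne hj]

/-- A block element is the explicit combination of the matrix units of its block with the
matrix entries of its `ψ`-image as coefficients. [cite: GoodmanWallachGTM255, §4.1] -/
theorem blockIdem_mul_mul_blockIdem_eq_sum {X : Module.End K V} (hX : X ∈ E) (i : Fin t) :
    blockIdem E ψ i * X * blockIdem E ψ i = ∑ a, ∑ b, ψ ⟨X, hX⟩ i a b • unit E ψ i a b := by
  have h := psi_blockIdem_mul_mul_blockIdem E ψ hX i
  have h2 : blockIdem E ψ i * X * blockIdem E ψ i = ↑(ψ.symm (Pi.single i (ψ ⟨X, hX⟩ i))) := by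
    rw [← h, AlgEquiv.symm_apply_apply]
  rw [h2]
  have hM : (Pi.single i (ψ ⟨X, hX⟩ i) : Π j, Matrix (Fin (d j)) (Fin (d j)) K) =
      ∑ a, ∑ b, ψ ⟨X, hX⟩ i a b • Pi.single i (Matrix.single a b (1 : K)) := by
    funext j
    simp only [Finset.sum_apply, Pi.smul_apply]
    by_cases hj : j = i
    · rw [hj]
      simp only [Pi.single_eq_same, Matrix.smul_single, smul_eq_mul, mul_one]
      exact Matrix.matrix_eq_sum_single _
    · simp only [Pi.single_eq_of_ne hj, smul_zero, Finset.sum_const_zero]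
  rw [hM, map_sum, AddSubmonoidClass.coe_finsetSum]
  refine Finset.sum_congr rfl fun a _ => ?_
  rw [map_sum, AddSubmonoidClass.coe_finsetSum]
  refine Finset.sum_congr rfl fun b _ => ?_
  rw [map_smul, Subalgebra.coe_smul]
  rfl

/-- Hence a block element lies in the span of the matrix units of its block.
[cite: GoodmanWallachGTM255, §4.1] -/
theorem blockIdem_mul_mem_mul_blockIdem {X : Module.End K V} (hX : X ∈ E) (i : Fin t) :
    blockIdem E ψ i * X * blockIdem E ψ i ∈
      Submodule.span K (Set.range fun ab : Fin (d i) × Fin (d i) => unit E ψ i ab.1 ab.2) := by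
  rw [blockIdem_mul_mul_blockIdem_eq_sum E ψ hX i]
  refine Submodule.sum_mem _ fun a _ => Submodule.sum_mem _ fun b _ =>
    Submodule.smul_mem _ _ (Submodule.subset_span ⟨(a, b), rfl⟩)

/-- An element of `E` is the sum of its block components. [cite: GoodmanWallachGTM255, §4.1] -/
theorem eq_sum_blockIdem_mul_mul_blockIdem {X : Module.End K V} (hX : X ∈ E) :
    X = ∑ i, blockIdem E ψ i * X * blockIdem E ψ i := by
  have h : ∀ i, blockIdem E ψ i * X * blockIdem E ψ i = X * blockIdem E ψ i := by
    intro i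
    rw [← blockIdem_comm E ψ hX i, mul_assoc, blockIdem_mul_blockIdem, if_pos rfl]
  simp_rw [h, ← Finset.mul_sum, sum_blockIdem, mul_one]

/-- A central idempotent of `E` has every Wedderburn component equal to `0` or `1`.
[cite: GoodmanWallachGTM255, §4.1] -/
theorem apply_eq_zero_or_one_of_central_idempotent {z : E} (hz2 : z * z = z)
    (hzc : ∀ x : E, x * z = z * x) (j : Fin t) [NeZero (d j)] : ψ z j = 0 ∨ ψ z j = 1 := by
  have hcomm : ∀ a b : Fin (d j), Commute (Matrix.single a b (1 : K)) (ψ z j) := by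
    intro a b
    have h := congrArg (fun y => y j) (congrArg ψ (hzc (ψ.symm (Pi.single j (Matrix.single a b 1)))))
    simp only [map_mul, AlgEquiv.apply_symm_apply, Pi.mul_apply, Pi.single_eq_same] at h
    exact h
  obtain ⟨r, hr⟩ := Matrix.mem_range_scalar_of_commute_single (M := ψ z j) fun a b _ => hcomm a b
  have hzz : ψ z j * ψ z j = ψ z j := by
    have := congrArg (fun y => y j) (congrArg ψ hz2)
    simpa [map_mul] using this
  rw [← hr, ← map_mul] at hzz
  have hr2 : r * r = r := Matrix.scalar_inj.1 hzz
  by_cases hr0 : r = 0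
  · left; rw [← hr, hr0, map_zero]
  · right
    have hr1 : r = 1 := mul_left_cancel₀ hr0 (by rw [hr2, mul_one])
    rw [← hr, hr1, map_one]

/-- `blockIdem` is injective in the block index. [cite: GoodmanWallachGTM255, §4.1] -/
theorem blockIdem_injective (hd : ∀ i, NeZero (d i)) : Function.Injective (blockIdem E ψ) := by
  intro i i' h
  by_contra hne
  have h1 : (Pi.single i (1 : Matrix (Fin (d i)) (Fin (d i)) K) : Π j, Matrix (Fin (d j)) (Fin (d j)) K)
      = Pi.single i' 1 := ψ.symm.injective (Subtype.ext h)
  have h2 := congrArg (fun y => y i) h1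
  simp only [Pi.single_eq_same, Pi.single_eq_of_ne hne] at h2
  haveI := hd i
  exact one_ne_zero h2

/-- Block idempotents are non-zero. [cite: GoodmanWallachGTM255, §4.1] -/
theorem blockIdem_ne_zero (hd : ∀ i, NeZero (d i)) (i : Fin t) : blockIdem E ψ i ≠ 0 := by
  intro h
  haveI := hd i
  have h1 : ψ.symm (Pi.single i (1 : Matrix (Fin (d i)) (Fin (d i)) K)) = 0 :=
    Subtype.ext (by rw [ZeroMemClass.coe_zero]; exact h)
  have h2 : (Pi.single i (1 : Matrix (Fin (d i)) (Fin (d i)) K) :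
      Π j, Matrix (Fin (d j)) (Fin (d j)) K) = 0 := by
    simpa using congrArg ψ h1
  have h3 := congrArg (fun y => y i) h2
  simp only [Pi.single_eq_same, Pi.zero_apply] at h3
  exact one_ne_zero h3

end Units

/-! ### The involution `bar` on blocks induced by the adjoint -/

section Bar

variable [FiniteDimensional K V] (B : LinearMap.BilinForm K V) (hB : B.Nondegenerate)
  (hBa : B.IsAlt) (E : Subalgebra K (Module.End K V)) (hE : ∀ X ∈ E, adj B hB X ∈ E)
  {t : ℕ} {d : Fin t → ℕ} (hd : ∀ i, NeZero (d i))
  (ψ : E ≃ₐ[K] Π i, Matrix (Fin (d i)) (Fin (d i)) K)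

/-- The adjoint of a block idempotent, as an element of `E`. [cite: Milne1999LefschetzClasses, §2] -/
noncomputable def adjBlockIdem (i : Fin t) : E := ⟨adj B hB (blockIdem E ψ i), hE _ (blockIdem_mem E ψ i)⟩

include hBa hd in
/-- Every component of `(1_i)†` is `0` or `1`. [cite: Milne1999LefschetzClasses, §2] -/
theorem psi_adjBlockIdem_eq_zero_or_one (i j : Fin t) :
    ψ (adjBlockIdem B hB E hE ψ i) j = 0 ∨ ψ (adjBlockIdem B hB E hE ψ i) j = 1 := by
  haveI := hd j
  apply apply_eq_zero_or_one_of_central_idempotent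
  · apply Subtype.ext
    change adj B hB (blockIdem E ψ i) * adj B hB (blockIdem E ψ i) = adj B hB (blockIdem E ψ i)
    rw [← adj_mul, blockIdem_mul_blockIdem, if_pos rfl]
  · intro x
    apply Subtype.ext
    change ↑x * adj B hB (blockIdem E ψ i) = adj B hB (blockIdem E ψ i) * ↑x
    conv_lhs => rw [← adj_adj_of_isAlt B hB hBa (↑x : Module.End K V)]
    rw [← adj_mul, ← blockIdem_comm E ψ (hE _ x.2) i, adj_mul, adj_adj_of_isAlt B hB hBa]

include hBa hd in
/-- Every block `j` meets some `(1_i)†`. [cite: Milne1999LefschetzClasses, §2] -/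
theorem exists_psi_adjBlockIdem_eq_one (j : Fin t) :
    ∃ i, ψ (adjBlockIdem B hB E hE ψ i) j = 1 := by
  by_contra h
  push Not at h
  have h0 : ∀ i, ψ (adjBlockIdem B hB E hE ψ i) j = 0 := fun i =>
    (psi_adjBlockIdem_eq_zero_or_one B hB hBa E hE hd ψ i j).resolve_right (h i)
  have hsum : ∑ i, adjBlockIdem B hB E hE ψ i = 1 := by
    apply Subtype.ext
    rw [AddSubmonoidClass.coe_finsetSum]
    change ∑ i, adj B hB (blockIdem E ψ i) = 1
    rw [← adj_sum, sum_blockIdem, adj_one]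
  have h1 := congrArg (fun y => y j) (congrArg ψ hsum)
  simp only [map_sum, Finset.sum_apply, h0, Finset.sum_const_zero, map_one, Pi.one_apply] at h1
  haveI := hd j
  exact one_ne_zero h1.symm

include hd in
/-- At most one `(1_i)†` meets a given block. [cite: Milne1999LefschetzClasses, §2] -/
theorem psi_adjBlockIdem_unique {i i' j : Fin t} (hi : ψ (adjBlockIdem B hB E hE ψ i) j = 1)
    (hi' : ψ (adjBlockIdem B hB E hE ψ i') j = 1) : i = i' := by
  by_contra hne
  have hmul : adjBlockIdem B hB E hE ψ i * adjBlockIdem B hB E hE ψ i' = 0 := by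
    apply Subtype.ext
    change adj B hB (blockIdem E ψ i) * adj B hB (blockIdem E ψ i') = 0
    rw [← adj_mul, blockIdem_mul_blockIdem, if_neg (Ne.symm hne), adj_zero]
  have h1 := congrArg (fun y => y j) (congrArg ψ hmul)
  simp only [map_mul, Pi.mul_apply, hi, hi', mul_one, map_zero, Pi.zero_apply] at h1
  haveI := hd j
  exact one_ne_zero h1

include hBa hd in
/-- Every `(1_i)†` meets some block. [cite: Milne1999LefschetzClasses, §2] -/
theorem exists_psi_adjBlockIdem_eq_one' (i : Fin t) :
    ∃ j, ψ (adjBlockIdem B hB E hE ψ i) j = 1 := by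
  by_contra h
  push Not at h
  have h0 : ψ (adjBlockIdem B hB E hE ψ i) = 0 := funext fun j =>
    (psi_adjBlockIdem_eq_zero_or_one B hB hBa E hE hd ψ i j).resolve_right (h j)
  have h1 : adjBlockIdem B hB E hE ψ i = 0 := by simpa using congrArg ψ.symm h0
  have h2 : adj B hB (blockIdem E ψ i) = 0 := congrArg Subtype.val h1
  have h3 : blockIdem E ψ i = 0 := by
    rw [← adj_adj_of_isAlt B hB hBa (blockIdem E ψ i), h2, adj_zero]
  exact blockIdem_ne_zero E ψ hd i h3

/-- The involution `i ↦ bar i` of the set of blocks with `(1_i)† = 1_{bar i}`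
(`adj_blockIdem`). [cite: Milne1999LefschetzClasses, §2] -/
noncomputable def bar (i : Fin t) : Fin t :=
  Classical.choose (exists_psi_adjBlockIdem_eq_one' B hB hBa E hE hd ψ i)

/-- Defining property of `bar`. [cite: Milne1999LefschetzClasses, §2] -/
theorem bar_spec (i : Fin t) : ψ (adjBlockIdem B hB E hE ψ i) (bar B hB hBa E hE hd ψ i) = 1 :=
  Classical.choose_spec (exists_psi_adjBlockIdem_eq_one' B hB hBa E hE hd ψ i)

/-- `bar i` is the only block met by `(1_i)†`. [cite: Milne1999LefschetzClasses, §2] -/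
theorem eq_bar_of_psi_eq_one {i j : Fin t} (h : ψ (adjBlockIdem B hB E hE ψ i) j = 1) :
    j = bar B hB hBa E hE hd ψ i := by
  let σ : Fin t → Fin t := fun j =>
    Classical.choose (exists_psi_adjBlockIdem_eq_one B hB hBa E hE hd ψ j)
  have hσ : ∀ j, ψ (adjBlockIdem B hB E hE ψ (σ j)) j = 1 := fun j =>
    Classical.choose_spec (exists_psi_adjBlockIdem_eq_one B hB hBa E hE hd ψ j)
  have hσ' : ∀ i j, ψ (adjBlockIdem B hB E hE ψ i) j = 1 → σ j = i := fun i j h =>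
    psi_adjBlockIdem_unique B hB E hE hd ψ (hσ j) h
  have hsurj : Function.Surjective σ := fun i =>
    ⟨bar B hB hBa E hE hd ψ i, hσ' _ _ (bar_spec B hB hBa E hE hd ψ i)⟩
  have hinj : Function.Injective σ := Finite.injective_iff_surjective.mpr hsurj
  apply hinj
  rw [hσ' i j h, hσ' i _ (bar_spec B hB hBa E hE hd ψ i)]

/-- `(1_i)† = 1_{bar i}`. [cite: Milne1999LefschetzClasses, §2] -/
theorem adj_blockIdem (i : Fin t) :
    adj B hB (blockIdem E ψ i) = blockIdem E ψ (bar B hB hBa E hE hd ψ i) := by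
  have h : ψ (adjBlockIdem B hB E hE ψ i) = Pi.single (bar B hB hBa E hE hd ψ i) 1 := by
    funext j
    by_cases hj : j = bar B hB hBa E hE hd ψ i
    · rw [hj, Pi.single_eq_same]; exact bar_spec B hB hBa E hE hd ψ i
    · rw [Pi.single_eq_of_ne hj]
      exact (psi_adjBlockIdem_eq_zero_or_one B hB hBa E hE hd ψ i j).resolve_right fun h1 =>
        hj (eq_bar_of_psi_eq_one B hB hBa E hE hd ψ h1)
  have h2 : adjBlockIdem B hB E hE ψ i = ψ.symm (Pi.single (bar B hB hBa E hE hd ψ i) 1) := by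
    rw [← h, AlgEquiv.symm_apply_apply]
  exact congrArg Subtype.val h2

/-- `bar` is an involution. [cite: Milne1999LefschetzClasses, §2] -/
theorem bar_bar (i : Fin t) : bar B hB hBa E hE hd ψ (bar B hB hBa E hE hd ψ i) = i := by
  apply blockIdem_injective E ψ hd
  rw [← adj_blockIdem, ← adj_blockIdem, adj_adj_of_isAlt B hB hBa]

/-- `bar` is injective. [cite: Milne1999LefschetzClasses, §2] -/
theorem bar_injective : Function.Injective (bar B hB hBa E hE hd ψ) := fun i j h => by
  rw [← bar_bar B hB hBa E hE hd ψ i, h, bar_bar]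

/-- Blocks `i` and `j ≠ bar i` are `B`-orthogonal. [cite: Milne1999LefschetzClasses, §2] -/
theorem form_blockIdem_blockIdem {i j : Fin t} (h : j ≠ bar B hB hBa E hE hd ψ i) (v w : V) :
    B (blockIdem E ψ i v) (blockIdem E ψ j w) = 0 := by
  rw [adj_spec' B hB hBa, adj_blockIdem B hB hBa E hE hd ψ, ← Module.End.mul_apply,
    blockIdem_mul_blockIdem, if_neg (Ne.symm h), LinearMap.zero_apply, map_zero]

end Bar

/-! ### Systems of matrix units of one block -/

section BlockSys

variable (E : Subalgebra K (Module.End K V))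

/-- A full system of `m × m` matrix units of `E` whose diagonal sums to the idempotent `P` and
whose span contains the corner `P E P`. [cite: GoodmanWallachGTM255, §4.1] -/
structure BlockSys (P : Module.End K V) where
  /-- the size of the system -/
  m : ℕ
  /-- the size is positive -/
  m_pos : 0 < m
  /-- the matrix units -/
  e : Fin m → Fin m → Module.End K V
  /-- they lie in `E` -/
  mem : ∀ a b, e a b ∈ E
  /-- multiplication table -/
  mul : ∀ a b b' c, e a b * e b' c = if b = b' then e a c else 0
  /-- the diagonal sums to `P` -/
  sum_diag : ∑ a, e a a = P
  /-- the corner `P E P` is spanned by the units -/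
  spans : ∀ X ∈ E, P * X * P ∈ Submodule.span K (Set.range fun ab : Fin m × Fin m => e ab.1 ab.2)

namespace BlockSys

variable {E} {P : Module.End K V} (S : BlockSys E P)

/-- The first index. [cite: GoodmanWallachGTM255, §4.1] -/
def zero : Fin S.m := ⟨0, S.m_pos⟩

/-- Units absorb `P` on the right. [cite: GoodmanWallachGTM255, §4.1] -/
theorem e_mul_P (a b : Fin S.m) : S.e a b * P = S.e a b := by
  have h : S.e a b * ∑ c, S.e c c = S.e a b := by
    rw [Finset.mul_sum]
    simp_rw [S.mul]
    rw [Finset.sum_ite_eq, if_pos (Finset.mem_univ _)]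
  rwa [S.sum_diag] at h

/-- Units absorb `P` on the left. [cite: GoodmanWallachGTM255, §4.1] -/
theorem P_mul_e (a b : Fin S.m) : P * S.e a b = S.e a b := by
  have h : (∑ c, S.e c c) * S.e a b = S.e a b := by
    rw [Finset.sum_mul]
    simp_rw [S.mul]
    rw [Finset.sum_ite_eq', if_pos (Finset.mem_univ _)]
  rwa [S.sum_diag] at h

include S in
/-- `P` is idempotent. [cite: GoodmanWallachGTM255, §4.1] -/
theorem P_mul_P : P * P = P := by
  have h : (∑ c, S.e c c) * P = ∑ c, S.e c c := by
    rw [Finset.sum_mul]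
    simp_rw [S.e_mul_P]
  rwa [S.sum_diag] at h

include S in
/-- `P ∈ E`. [cite: GoodmanWallachGTM255, §4.1] -/
theorem P_mem : P ∈ E := by
  have h : ∑ c, S.e c c ∈ E := Subalgebra.sum_mem _ fun a _ => S.mem a a
  rwa [S.sum_diag] at h

end BlockSys

variable {t : ℕ} {d : Fin t → ℕ} (ψ : E ≃ₐ[K] Π i, Matrix (Fin (d i)) (Fin (d i)) K)

/-- The Wedderburn system of matrix units of block `i`. [cite: GoodmanWallachGTM255, §4.1] -/
noncomputable def wedderburnSys (i : Fin t) [NeZero (d i)] : BlockSys E (blockIdem E ψ i) where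
  m := d i
  m_pos := Nat.pos_of_ne_zero (NeZero.ne _)
  e := unit E ψ i
  mem := unit_mem E ψ i
  mul := unit_mul_unit E ψ i
  sum_diag := sum_unit_diag E ψ i
  spans := fun _ hX => blockIdem_mul_mem_mul_blockIdem E ψ hX i

variable [FiniteDimensional K V] (B : LinearMap.BilinForm K V) (hB : B.Nondegenerate)
  (hBa : B.IsAlt) (hE : ∀ X ∈ E, adj B hB X ∈ E)

variable {E} in
/-- The adjoint-transpose `f_{ab} := (e_{ba})†` of a system of matrix units: a system for the
block `P†`. [cite: Milne1999LefschetzClasses, §2] -/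
noncomputable def BlockSys.transpose {P : Module.End K V} (S : BlockSys E P) (Q : Module.End K V)
    (hQ : adj B hB P = Q) : BlockSys E Q where
  m := S.m
  m_pos := S.m_pos
  e := fun a b => adj B hB (S.e b a)
  mem := fun a b => hE _ (S.mem b a)
  mul := by
    intro a b b' c
    rw [← adj_mul, S.mul]
    split_ifs with h1 h2 h2
    · rfl
    · exact absurd h1.symm h2
    · exact absurd h2.symm h1
    · exact adj_zero B hB
  sum_diag := by rw [← adj_sum, S.sum_diag, hQ]
  spans := by
    intro X hX
    have h1 : Q * X * Q = adj B hB (P * adj B hB X * P) := by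
      rw [adj_mul, adj_mul, adj_adj_of_isAlt B hB hBa, hQ, mul_assoc]
    have h2 := S.spans (adj B hB X) (hE X hX)
    have h3 : adjLinear B hB (P * adj B hB X * P) ∈
        Submodule.map (adjLinear B hB)
          (Submodule.span K (Set.range fun ab : Fin S.m × Fin S.m => S.e ab.1 ab.2)) :=
      Submodule.mem_map_of_mem h2
    rw [Submodule.map_span] at h3
    rw [h1, ← adjLinear_apply B hB]
    refine Submodule.span_mono ?_ h3
    rintro _ ⟨_, ⟨⟨a, b⟩, rfl⟩, rfl⟩
    exact ⟨(b, a), rfl⟩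

/-! ### The corner `f₀₀ E e₀₀` of a self-dual block is a line -/

/-- For a second system `S` of `d_i × d_i` matrix units of the Wedderburn block `i` (in the
application: the adjoint-transpose of the Wedderburn system of a self-dual block), all the
sandwiches `S.e 0 0 * X * e^i_{00}`, `X ∈ E`, are multiples of one of them: the corner
`f₀₀ M_d(K) e₀₀` of two rank-one idempotents is a line (dimension count
`d² · dim (f₀₀ E e₀₀) ≤ dim M_d(K) = d²`). [cite: GoodmanWallachGTM255, §4.1] -/
theorem exists_smul_eq_sandwich (i : Fin t) [NeZero (d i)] (S : BlockSys E (blockIdem E ψ i))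
    (hm : S.m = d i) :
    ∃ κ : Module.End K V, (∃ X₀ ∈ E, κ = S.e S.zero S.zero * X₀ * unit E ψ i 0 0) ∧
      ∀ X ∈ E, ∃ c : K, S.e S.zero S.zero * X * unit E ψ i 0 0 = c • κ := by
  classical
  -- the sandwich map and its range
  let L : E →ₗ[K] Module.End K V :=
    (LinearMap.mulLeft K (S.e S.zero S.zero)).comp
      ((LinearMap.mulRight K (unit E ψ i 0 0)).comp E.val.toLinearMap)
  have hL : ∀ X : E, L X = S.e S.zero S.zero * ↑X * unit E ψ i 0 0 := fun X => by
    simp [L, mul_assoc]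
  let W : Submodule K (Module.End K V) := LinearMap.range L
  have hWE : ∀ w ∈ W, w ∈ E := by
    rintro _ ⟨X, rfl⟩
    rw [hL]
    exact E.mul_mem (E.mul_mem (S.mem _ _) X.2) (unit_mem E ψ i 0 0)
  have hWfix : ∀ w ∈ W, S.e S.zero S.zero * w * unit E ψ i 0 0 = w := by
    rintro _ ⟨X, rfl⟩
    rw [hL, ← mul_assoc, ← mul_assoc, S.mul, if_pos rfl, mul_assoc _ (unit E ψ i 0 0),
      unit_mul_unit, if_pos rfl]
  -- the block element built from a matrix of corner elements
  let Y : (Fin S.m → Fin (d i) → W) → Module.End K V := fun w =>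
    ∑ a, ∑ c, S.e a S.zero * ↑(w a c) * unit E ψ i 0 c
  have hYadd : ∀ w w', Y (w + w') = Y w + Y w' := by
    intro w w'
    simp only [Y, Pi.add_apply, Submodule.coe_add, mul_add, add_mul, Finset.sum_add_distrib]
  have hYsmul : ∀ (c : K) (w), Y (c • w) = c • Y w := by
    intro c w
    simp only [Y, Pi.smul_apply, Submodule.coe_smul, mul_smul_comm, smul_mul_assoc, Finset.smul_sum]
  have hYmem : ∀ w, Y w ∈ E := fun w =>
    Subalgebra.sum_mem _ fun a _ => Subalgebra.sum_mem _ fun c _ =>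
      E.mul_mem (E.mul_mem (S.mem _ _) (hWE _ (w a c).2)) (unit_mem E ψ i 0 c)
  have hYblock : ∀ w, blockIdem E ψ i * Y w * blockIdem E ψ i = Y w := by
    intro w
    simp only [Y, Finset.mul_sum, Finset.sum_mul]
    refine Finset.sum_congr rfl fun a _ => Finset.sum_congr rfl fun c _ => ?_
    calc blockIdem E ψ i * (S.e a S.zero * ↑(w a c) * unit E ψ i 0 c) * blockIdem E ψ i
        = (blockIdem E ψ i * S.e a S.zero) * ↑(w a c) * (unit E ψ i 0 c * blockIdem E ψ i) := by
          simp only [mul_assoc]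
      _ = S.e a S.zero * ↑(w a c) * unit E ψ i 0 c := by rw [S.P_mul_e, unit_mul_blockIdem]
  have hkey : ∀ w a₀ c₀, S.e S.zero a₀ * Y w * unit E ψ i c₀ 0 = ↑(w a₀ c₀) := by
    intro w a₀ c₀
    simp only [Y, Finset.mul_sum, Finset.sum_mul]
    have hterm : ∀ a c, S.e S.zero a₀ * (S.e a S.zero * ↑(w a c) * unit E ψ i 0 c) *
        unit E ψ i c₀ 0 = if a₀ = a ∧ c = c₀ then (↑(w a₀ c₀) : Module.End K V) else 0 := by
      intro a c
      calc S.e S.zero a₀ * (S.e a S.zero * ↑(w a c) * unit E ψ i 0 c) * unit E ψ i c₀ 0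
          = (S.e S.zero a₀ * S.e a S.zero) * ↑(w a c) * (unit E ψ i 0 c * unit E ψ i c₀ 0) := by
            simp only [mul_assoc]
        _ = if a₀ = a ∧ c = c₀ then (↑(w a₀ c₀) : Module.End K V) else 0 := by
            rw [S.mul, unit_mul_unit]
            by_cases ha : a₀ = a
            · subst ha
              by_cases hc : c = c₀
              · subst hc
                rw [if_pos rfl, if_pos rfl, if_pos ⟨rfl, rfl⟩, hWfix _ (w a₀ c).2]
              · rw [if_neg hc, mul_zero, if_neg fun h => hc h.2]
            · rw [if_neg ha, zero_mul, zero_mul, if_neg fun h => ha h.1]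
    simp_rw [hterm]
    rw [Finset.sum_eq_single a₀]
    · rw [Finset.sum_eq_single c₀]
      · rw [if_pos ⟨rfl, rfl⟩]
      · intro c _ hc; rw [if_neg fun h => hc h.2]
      · intro h; exact absurd (Finset.mem_univ _) h
    · intro a _ ha
      exact Finset.sum_eq_zero fun c _ => if_neg fun h => ha h.1.symm
    · intro h; exact absurd (Finset.mem_univ _) h
  -- the linear map `w ↦ (ψ (Y w)) i` is injective
  let Φ : (Fin S.m → Fin (d i) → W) →ₗ[K] Matrix (Fin (d i)) (Fin (d i)) K :=
    { toFun := fun w => ψ ⟨Y w, hYmem w⟩ i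
      map_add' := fun w w' => by
        have h : (⟨Y (w + w'), hYmem _⟩ : E) = ⟨Y w, hYmem w⟩ + ⟨Y w', hYmem w'⟩ :=
          Subtype.ext (hYadd w w')
        rw [h, map_add, Pi.add_apply]
      map_smul' := fun c w => by
        have h : (⟨Y (c • w), hYmem _⟩ : E) = c • ⟨Y w, hYmem w⟩ := Subtype.ext (hYsmul c w)
        rw [h, map_smul, Pi.smul_apply, RingHom.id_apply] }
  have hΦ : Function.Injective Φ := by
    intro w w' hww
    rw [← sub_eq_zero] at hww ⊢
    rw [← map_sub] at hww
    set u := w - w' with hu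
    have h1 : ψ ⟨Y u, hYmem u⟩ = 0 := by
      have h2 : ψ ⟨Y u, hYmem u⟩ = Pi.single i (ψ ⟨Y u, hYmem u⟩ i) := by
        have h3 := psi_blockIdem_mul_mul_blockIdem E ψ (hYmem u) i
        rw [← h3]
        congr 1
        exact Subtype.ext (hYblock u).symm
      rw [h2]
      have h6 : ψ ⟨Y u, hYmem u⟩ i = 0 := hww
      rw [h6, Pi.single_zero]
    have h4 : Y u = 0 := by
      have h5 : (⟨Y u, hYmem u⟩ : E) = 0 := by simpa using congrArg ψ.symm h1
      exact congrArg Subtype.val h5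
    funext a c
    apply Subtype.ext
    rw [← hkey u a c, h4, mul_zero, zero_mul]
    rfl
  -- dimension count
  have hdim := LinearMap.finrank_le_finrank_of_injective hΦ
  have hl : Module.finrank K (Fin S.m → Fin (d i) → W) = d i * (d i * Module.finrank K W) := by
    rw [Module.finrank_pi_fintype K]
    simp_rw [Module.finrank_pi_fintype K, Finset.sum_const, Finset.card_univ, Fintype.card_fin,
      smul_eq_mul, hm]
  have hr : Module.finrank K (Matrix (Fin (d i)) (Fin (d i)) K) = d i * (d i * 1) := by
    simp [Module.finrank_matrix]
  rw [hl, hr] at hdim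
  have hpos : 0 < d i := Nat.pos_of_ne_zero (NeZero.ne _)
  have hW1 : Module.finrank K W ≤ 1 :=
    Nat.le_of_mul_le_mul_left (Nat.le_of_mul_le_mul_left hdim hpos) hpos
  obtain ⟨v, hv⟩ := finrank_le_one_iff.1 hW1
  obtain ⟨X₀, hX₀⟩ := LinearMap.mem_range.1 v.2
  refine ⟨↑v, ⟨↑X₀, X₀.2, by rw [← hX₀, hL]⟩, fun X hX => ?_⟩
  obtain ⟨c, hc⟩ := hv ⟨L ⟨X, hX⟩, LinearMap.mem_range_self L _⟩
  refine ⟨c, ?_⟩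
  have hc' := congrArg Subtype.val hc
  simp only [Submodule.coe_smul] at hc'
  rw [← hL ⟨X, hX⟩]
  exact hc'.symm

end BlockSys

end Literature.RingTheory.SimpleModule
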